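import Literature.Geometry.Riemannian.SingularTimeBoundedSet
import Literature.Geometry.Riemannian.PinchingCurvatureBound
import HarnessLib

/-!
# At a singular time of a stage the curvature is unbounded: `Ω ≠ M` (Chen–Zhu 2006, §4)
(topic `Geometry/Riemannian`)

A step of the surgery construction behind
`Literature.Geometry.Riemannian.chenZhu_ricciFlowWithSurgery` (B.-L. Chen, X.-P. Zhu,
J. Differential Geom. 74 (2006), arXiv:math/0504478, Thm. 1.1). Chen–Zhu, §4, p. 19: for the
maximal solution "the maximal time `T` must be finite and the curvature tensor becomes unbounded
as `t → T`"; p. 24: `Ω` is "the set of all points in `M`, where curvature stays bounded as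
`t → T`" and "`R(x,t) → +∞` as `t → T` for each `x ∈ M ∖ Ω`". For a stage of a surgical solution
which is a MAXIMAL Ricci flow satisfying the a priori assumptions (`ChenZhuAPriori`,
`SurgicalSolutions.lean`), this file PROVES from the named fact
`Literature.Geometry.Riemannian.ricciFlow_curvature_blowup` (Topping 2006, Thm. 5.3.1 /
Hamilton 1982, Thm. 14.1, taken as a hypothesis `(h : ricciFlow_curvature_blowup)`) that
`Ω ≠ M`: otherwise the uniform bound `R ≤ K` on the compact `M × [0, T)`
(`ChenZhuAPriori.exists_forall_scalarCurvature_le_of_isCompact`, `SingularTimeBoundedSet.lean`)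
and the pinching assumption (`ChenZhuAPriori.curvatureBoundedOn_setOf_scalarCurvature_le`,
`PinchingCurvatureBound.lean`) would bound the whole curvature tensor up to `T`, contradicting
the blow-up at a finite maximal time.

* `ChenZhuAPriori.curvatureBoundedBy_of_forall_scalarCurvature_le` — `R ≤ K` on `M × [0, T)`
  gives `CurvatureBoundedBy (g t) (cov t) (288 (Λ (K/6 + ρ) + ρ))` for all `t`;
* `ChenZhuAPriori.boundedCurvatureSet_ne_univ` — **`Ω ≠ M`** for a maximal stage;
* `ChenZhuAPriori.exists_tendsto_scalarCurvature_atTop` — hence **some point has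
  `R(x, t) → +∞` as `t ↑ T`**.

Everything here is proved; no definitions, no named facts.

## References

* B.-L. Chen, X.-P. Zhu, *Ricci flow with surgery on four-manifolds with positive isotropic
  curvature*, J. Differential Geom. 74 (2006) 177–264 (arXiv:math/0504478), §4, p. 19 and
  p. 24. [ChenZhu2006]
* P. Topping, *Lectures on the Ricci flow*, LMS Lecture Note Series 325 (2006), Thm. 5.3.1.
  [Topping2006]
-/

noncomputable section

open Bundle Set Function Filter TopologicalSpace
open scoped Manifold ContDiff Topology

namespace Literature.Geometry.Riemannian

open Lorentzian

section Stage

variable {M : Type} [TopologicalSpace M] [T2Space M] [SecondCountableTopology M] [CompactSpace M]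
  [ChartedSpace (EuclideanSpace ℝ (Fin 4)) M] [IsManifold (𝓡 4) ∞ M] [MeasurableSpace M]
  [BorelSpace M] {𝔭 : ChenZhuAPrioriParams}
  {g : ℝ → PseudoRiemannianMetric (𝓡 4) ∞ (EuclideanSpace ℝ (Fin 4)) (TangentSpace (𝓡 4) : M → Type _)}
  {cov : ℝ → CovariantDerivative (𝓡 4) (EuclideanSpace ℝ (Fin 4)) (TangentSpace (𝓡 4) : M → Type _)}
  {T t₀ : ℝ}

omit [SecondCountableTopology M] in
/-- **A uniform scalar-curvature bound bounds the curvature tensor uniformly** for a stage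
satisfying the a priori assumptions: `R ≤ K` on `M × [0, T)` gives
`CurvatureBoundedBy (g t) (cov t) (288 (Λ (K/6 + ρ) + ρ))` for every `t ∈ [0, T)`
(`ChenZhuAPriori.curvatureBoundedOn_setOf_scalarCurvature_le` on the whole manifold).
[cite: ChenZhu2006, §5, p. 26, (5.1)–(5.2)] -/
theorem ChenZhuAPriori.curvatureBoundedBy_of_forall_scalarCurvature_le
    (hA : ChenZhuAPriori 𝔭 g cov T t₀) (hflow : IsRicciFlow g cov (Ico 0 T))
    (hRiem : ∀ t ∈ Ico 0 T, (g t).IsRiemannian) (hρ : 0 ≤ 𝔭.ρ) (hΛ : 0 ≤ 𝔭.Λ) {K : ℝ}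
    (hK : ∀ y : M, ∀ t ∈ Ico 0 T, (g t).scalarCurvatureWith (cov t) y ≤ K) {t : ℝ}
    (ht : t ∈ Ico 0 T) : CurvatureBoundedBy (g t) (cov t) (288 * (𝔭.Λ * (K / 6 + 𝔭.ρ) + 𝔭.ρ)) := by
  rw [← curvatureBoundedOn_univ_iff]
  exact (hA.curvatureBoundedOn_setOf_scalarCurvature_le hflow hRiem hρ hΛ ht K).mono
    (fun y _ ↦ hK y t ht) le_rfl

/-- **`Ω ≠ M` at the singular time of a maximal stage** (Chen–Zhu 2006, §4, p. 19: "the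
curvature tensor becomes unbounded as `t → T`"; p. 24), given the curvature blow-up theorem
`ricciFlow_curvature_blowup` (Topping 2006, Thm. 5.3.1) as a hypothesis: if `Ω` were all of
`M`, compactness (`ChenZhuAPriori.exists_forall_scalarCurvature_le_of_isCompact`) and pinching
(`curvatureBoundedBy_of_forall_scalarCurvature_le`) would bound `|Rm|` on `M × [0, T)`.
[cite: ChenZhu2006, §4, p. 19 and p. 24] [cite: Topping2006, Thm. 5.3.1] -/
theorem ChenZhuAPriori.boundedCurvatureSet_ne_univ (hblow : ricciFlow_curvature_blowup.{0, 0, 0})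
    (hA : ChenZhuAPriori 𝔭 g cov T t₀) (hmax : IsMaximalRicciFlow g cov T) (ht₀ : 0 ≤ t₀)
    (hη : 0 < 𝔭.η) (hρ : 0 ≤ 𝔭.ρ) (hΛ : 0 ≤ 𝔭.Λ) (hrpos : ∀ t ∈ Ici (0 : ℝ), 0 < 𝔭.r t)
    (hranti : AntitoneOn 𝔭.r (Ici 0)) : boundedCurvatureSet g cov T ≠ univ := by
  intro huniv
  obtain ⟨K, hK⟩ := hA.exists_forall_scalarCurvature_le_of_isCompact hmax.isRicciFlow
    hmax.isRiemannian hmax.pos ht₀ hη hrpos hranti isCompact_univ (by rw [huniv])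
  set C : ℝ := 288 * (𝔭.Λ * (K / 6 + 𝔭.ρ) + 𝔭.ρ) with hC
  obtain ⟨t₁, ht₁, hnot⟩ := hblow (𝓡 4) M T g cov hmax C
  exact hnot t₁ ⟨le_rfl, ht₁.2⟩ (hA.curvatureBoundedBy_of_forall_scalarCurvature_le
    hmax.isRicciFlow hmax.isRiemannian hρ hΛ (fun y t ht ↦ hK y (mem_univ y) t ht) ht₁)

/-- **Some point has `R(x, t) → +∞` as `t ↑ T`** at the singular time of a maximal stage
satisfying the a priori assumptions (Chen–Zhu 2006, §4, p. 19 and p. 24), given the curvature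
blow-up theorem: a point outside `Ω` (`boundedCurvatureSet_ne_univ`) and
`ChenZhuAPriori.tendsto_scalarCurvature_atTop_of_not_mem`.
[cite: ChenZhu2006, §4, p. 19 and p. 24] [cite: Topping2006, Thm. 5.3.1] -/
theorem ChenZhuAPriori.exists_tendsto_scalarCurvature_atTop
    (hblow : ricciFlow_curvature_blowup.{0, 0, 0}) (hA : ChenZhuAPriori 𝔭 g cov T t₀)
    (hmax : IsMaximalRicciFlow g cov T) (ht₀ : 0 ≤ t₀) (hη : 0 < 𝔭.η) (hρ : 0 ≤ 𝔭.ρ)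
    (hΛ : 0 ≤ 𝔭.Λ) (hrpos : ∀ t ∈ Ici (0 : ℝ), 0 < 𝔭.r t) (hranti : AntitoneOn 𝔭.r (Ici 0)) :
    ∃ x : M, Tendsto (fun t ↦ (g t).scalarCurvatureWith (cov t) x) (𝓝[<] T) atTop := by
  obtain ⟨x, hx⟩ : ∃ x, x ∉ boundedCurvatureSet g cov T := by
    by_contra h
    push Not at h
    exact hA.boundedCurvatureSet_ne_univ hblow hmax ht₀ hη hρ hΛ hrpos hranti
      (eq_univ_of_forall h)
  exact ⟨x, hA.tendsto_scalarCurvature_atTop_of_not_mem hmax.isRicciFlow hmax.pos ht₀ hη hrpos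
    hranti hx⟩

end Stage

end Literature.Geometry.Riemannian

end
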